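import Mathlib.Analysis.InnerProductSpace.Projection.Reflection
import Literature.Analysis.FluidPDE.VectorCalculus
import Literature.Analysis.FluidPDE.LagrangianTimeDerivativeTools
import HarnessLib

/-!
# Isometry tools for the crux `IsobaricLinesLiouville` (stmt-NavierStokesRegularity-11741),
# line `Ideator2Sketch` (card `flux-surface-persistence`)

Helper file of the line lead (supports the crux; no statement item is closed here; theorems
only, no definitions). The line normalises a hidden symmetry axis / vorticity direction by a
rigid motion `y ↦ R⁻¹ y + c` (`stub_covariance`), so the composition needs how `cross` and `curl`
transform under a linear isometry `R` of `ℝ³ = EuclideanSpace ℝ (Fin 3)`, possibly improper: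

* `cross_map_isometry : ∃ ε = ±1, ∀ a b, cross (R a) (R b) = ε • R (cross a b)` (cofactor identity
  through the triple product `u ⬝ᵥ (v ⨯₃ w) = det ![u, v, w]`, Mathlib `triple_product_eq_det`;
  `ε = det R`, kept existential so that no definition is introduced);
* `curl_conj_isometry : ∃ ε = ±1, (cross rule) ∧ ∀ c v y, … →
  curl (fun z => R (v (R.symm z + c))) y = ε • R (curl v (R.symm y + c))`
  (chain rule + the tree's characterisation `inner_cross_curl`);
* `exists_isometry_map_eq : ∃ R, R a = ‖a‖ • e` for a unit vector `e` (Householder reflection,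
  Mathlib `Submodule.reflection_sub`); `cross_smul_left'`; `curl_const_eq_zero`;
  `sliceConst_of_conj` (slice-wise constancy passes back through the rigid motion).

The matrix bookkeeping is done for an arbitrary matrix `M` representing `R` in coordinates
(`hM : ∀ x, M *ᵥ ofLp x = ofLp (R x)`), instantiated with `LinearMap.toMatrix'`.
Sources: Majda–Bertozzi, *Vorticity and Incompressible Flow*, §1.1 (vector identities), §1.2
(symmetry groups of the equations); elementary linear algebra.
-/

noncomputable section

-- the summit and its single problem share the name (D-0017 nested layout)
set_option linter.dupNamespace false

namespace Summit.NavierStokesRegularity.NavierStokesRegularity.Theorems.IsobaricLinesLiouville.FluxSurfacePersistence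

open scoped InnerProductSpace RealInnerProductSpace Matrix
open Literature.Analysis.FluidPDE WithLp

/-! ### A coordinate matrix of a linear isometry -/

/-- Every linear isometry of `ℝ³` is represented by a matrix in standard coordinates:
`M *ᵥ ofLp x = ofLp (R x)` with `M = LinearMap.toMatrix'` of the transported linear map. -/
theorem exists_matrix_repr (R : (EuclideanSpace ℝ (Fin 3)) ≃ₗᵢ[ℝ] (EuclideanSpace ℝ (Fin 3))) :
    ∃ M : Matrix (Fin 3) (Fin 3) ℝ, ∀ x : (EuclideanSpace ℝ (Fin 3)), M *ᵥ ofLp x = ofLp (R x) := by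
  refine ⟨LinearMap.toMatrix' ((WithLp.linearEquiv 2 ℝ (Fin 3 → ℝ)).toLinearMap ∘ₗ
    R.toLinearEquiv.toLinearMap ∘ₗ (WithLp.linearEquiv 2 ℝ (Fin 3 → ℝ)).symm.toLinearMap), fun x => ?_⟩
  rw [LinearMap.toMatrix'_mulVec]
  rfl

/-- The dot product of coordinates is the Euclidean inner product. -/
theorem dotProduct_ofLp (x y : (EuclideanSpace ℝ (Fin 3))) : ofLp x ⬝ᵥ ofLp y = ⟪x, y⟫_ℝ := by
  simp [EuclideanSpace.inner_eq_star_dotProduct, dotProduct_comm]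

section Repr

variable {R : (EuclideanSpace ℝ (Fin 3)) ≃ₗᵢ[ℝ] (EuclideanSpace ℝ (Fin 3))} {M : Matrix (Fin 3) (Fin 3) ℝ}

/-- A representing matrix preserves the dot product. -/
theorem repr_mulVec_dotProduct (hM : ∀ x : (EuclideanSpace ℝ (Fin 3)), M *ᵥ ofLp x = ofLp (R x)) (u w : Fin 3 → ℝ) :
    (M *ᵥ u) ⬝ᵥ (M *ᵥ w) = u ⬝ᵥ w := by
  have hu : u = ofLp (toLp 2 u) := rfl
  have hw : w = ofLp (toLp 2 w) := rfl
  rw [hu, hw, hM, hM, dotProduct_ofLp, dotProduct_ofLp, LinearIsometryEquiv.inner_map_map]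

/-- A representing matrix is orthogonal: `Mᵀ * M = 1`. -/
theorem repr_transpose_mul_self (hM : ∀ x : (EuclideanSpace ℝ (Fin 3)), M *ᵥ ofLp x = ofLp (R x)) : Mᵀ * M = 1 := by
  ext i j
  have h := repr_mulVec_dotProduct hM (Pi.single i 1) (Pi.single j 1)
  rw [Matrix.mulVec_single_one, Matrix.mulVec_single_one, dotProduct_comm] at h
  simp only [single_dotProduct, one_mul] at h
  rw [Matrix.mul_apply]
  simp only [Matrix.transpose_apply]
  rw [show (∑ k, M k i * M k j) = (fun k => M k j) ⬝ᵥ (fun k => M k i) by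
    simp [dotProduct, mul_comm]]
  change M.col j ⬝ᵥ M.col i = _ at h ⊢
  · simpa [Matrix.one_apply, Pi.single_apply, eq_comm] using h

/-- The determinant of a representing matrix is `±1`. -/
theorem repr_det_eq_one_or (hM : ∀ x : (EuclideanSpace ℝ (Fin 3)), M *ᵥ ofLp x = ofLp (R x)) :
    M.det = 1 ∨ M.det = -1 := by
  have h := congrArg Matrix.det (repr_transpose_mul_self hM)
  rw [Matrix.det_mul, Matrix.det_transpose, Matrix.det_one] at h
  have : (M.det - 1) * (M.det + 1) = 0 := by nlinarith [h]
  rcases mul_eq_zero.1 this with h1 | h1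
  · left; linarith
  · right; linarith

/-- **Cross product under a linear isometry, matrix form**:
`cross (R a) (R b) = det M • R (cross a b)` for a representing matrix `M`
(the triple product transforms with `det M`, `u ⬝ᵥ (v ⨯₃ w) = det ![u, v, w]`). -/
theorem repr_cross_map (hM : ∀ x : (EuclideanSpace ℝ (Fin 3)), M *ᵥ ofLp x = ofLp (R x)) (a b : (EuclideanSpace ℝ (Fin 3))) :
    cross (R a) (R b) = M.det • R (cross a b) := by
  -- triple products transform with `det M`
  have key : ∀ u : Fin 3 → ℝ,
      (M *ᵥ u) ⬝ᵥ ((M *ᵥ ofLp a) ⨯₃ (M *ᵥ ofLp b)) = M.det * (u ⬝ᵥ (ofLp a ⨯₃ ofLp b)) := by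
    intro u
    rw [triple_product_eq_det, triple_product_eq_det]
    have hrows : Matrix.of ![M *ᵥ u, M *ᵥ ofLp a, M *ᵥ ofLp b] =
        Matrix.of ![u, ofLp a, ofLp b] * Mᵀ := by
      ext i j
      rw [Matrix.mul_apply]
      fin_cases i <;> simp [Matrix.mulVec, dotProduct, Matrix.transpose_apply, mul_comm]
    change Matrix.det (Matrix.of ![M *ᵥ u, M *ᵥ ofLp a, M *ᵥ ofLp b]) =
      M.det * Matrix.det (Matrix.of ![u, ofLp a, ofLp b])
    rw [hrows, Matrix.det_mul, Matrix.det_transpose, mul_comm]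
  -- compare against `M (a × b)` through the preserved dot product
  have key2 : ∀ u : Fin 3 → ℝ,
      (M *ᵥ u) ⬝ᵥ ((M *ᵥ ofLp a) ⨯₃ (M *ᵥ ofLp b) - M.det • (M *ᵥ (ofLp a ⨯₃ ofLp b))) = 0 := by
    intro u
    rw [dotProduct_sub, key, dotProduct_smul, repr_mulVec_dotProduct hM, smul_eq_mul, sub_self]
  -- `M *ᵥ` is surjective (`M` is invertible), so the bracket vanishes
  have hsurj : ∀ z : Fin 3 → ℝ, ∃ u, M *ᵥ u = z := by
    intro z
    refine ⟨Mᵀ *ᵥ z, ?_⟩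
    have h1 : M * Mᵀ = 1 := mul_eq_one_comm.1 (repr_transpose_mul_self hM)
    rw [Matrix.mulVec_mulVec, h1, Matrix.one_mulVec]
  set z := (M *ᵥ ofLp a) ⨯₃ (M *ᵥ ofLp b) - M.det • (M *ᵥ (ofLp a ⨯₃ ofLp b)) with hz
  have hz0 : z = 0 := by
    obtain ⟨u, hu⟩ := hsurj z
    have := key2 u
    rw [hu] at this
    exact dotProduct_self_eq_zero.1 this
  -- back to `EuclideanSpace`
  have hcoord : ofLp (cross (R a) (R b)) = ofLp (M.det • R (cross a b)) := by
    rw [ofLp_smul]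
    simp only [cross, ofLp_toLp]
    rw [← hM a, ← hM b, ← hM (toLp 2 (ofLp a ⨯₃ ofLp b)), ofLp_toLp]
    exact sub_eq_zero.1 hz0
  exact (WithLp.ofLp_injective 2) hcoord |>.symm ▸ rfl

end Repr

/-! ### Public statements (existential sign `ε = det R = ±1`) -/

/-- **Equivariance of the cross product under linear isometries of `ℝ³`**: there is a sign
`ε = ±1` (the determinant of `R`) with `cross (R a) (R b) = ε • R (cross a b)` for all `a`, `b`. -/
theorem cross_map_isometry :
    ∀ (R : (EuclideanSpace ℝ (Fin 3)) ≃ₗᵢ[ℝ] (EuclideanSpace ℝ (Fin 3))),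
      ∃ ε : ℝ, (ε = 1 ∨ ε = -1) ∧
        ∀ a b : (EuclideanSpace ℝ (Fin 3)), cross (R a) (R b) = ε • R (cross a b) := by
  intro R
  obtain ⟨M, hM⟩ := exists_matrix_repr R
  exact ⟨M.det, repr_det_eq_one_or hM, repr_cross_map hM⟩

/-- A vector orthogonal to all cross products vanishes (test against `e₁ × e₂ = e₀`,
`e₂ × e₀ = e₁`, `e₀ × e₁ = e₂`). -/
theorem eq_zero_of_inner_cross (w : (EuclideanSpace ℝ (Fin 3))) (h : ∀ a b : (EuclideanSpace ℝ (Fin 3)), ⟪cross a b, w⟫_ℝ = 0) : w = 0 := by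
  have e2 : cross (EuclideanSpace.single 0 (1 : ℝ)) (EuclideanSpace.single 1 (1 : ℝ)) =
      EuclideanSpace.single 2 (1 : ℝ) := by
    ext i; fin_cases i <;> simp [cross, cross_apply]
  have e0 : cross (EuclideanSpace.single 1 (1 : ℝ)) (EuclideanSpace.single 2 (1 : ℝ)) =
      EuclideanSpace.single 0 (1 : ℝ) := by
    ext i; fin_cases i <;> simp [cross, cross_apply]
  have e1 : cross (EuclideanSpace.single 2 (1 : ℝ)) (EuclideanSpace.single 0 (1 : ℝ)) =
      EuclideanSpace.single 1 (1 : ℝ) := by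
    ext i; fin_cases i <;> simp [cross, cross_apply]
  have h0 := h (EuclideanSpace.single 1 1) (EuclideanSpace.single 2 1)
  have h1 := h (EuclideanSpace.single 2 1) (EuclideanSpace.single 0 1)
  have h2 := h (EuclideanSpace.single 0 1) (EuclideanSpace.single 1 1)
  rw [e0, EuclideanSpace.inner_single_left] at h0
  rw [e1, EuclideanSpace.inner_single_left] at h1
  rw [e2, EuclideanSpace.inner_single_left] at h2
  ext i
  fin_cases i
  · simpa using h0
  · simpa using h1
  · simpa using h2

/-- **Curl of a conjugated field.** For a linear isometry `R` of `ℝ³` there is a sign `ε = ±1`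
(its determinant) such that `cross (R a) (R b) = ε • R (cross a b)` and, for every shift `c`,
every field `v` differentiable at `x = R⁻¹ y + c`,
`curl (fun z => R (v (R⁻¹ z + c))) y = ε • R (curl v x)`
(chain rule `Dv'(y) = R ∘ Dv(x) ∘ R⁻¹`, the characterisation `⟪a × b, curl ψ⟫ = ⟪b, Dψ a⟫ − ⟪a, Dψ b⟫`
of the tree (`inner_cross_curl`), and the cross rule for `R⁻¹`, whose sign is the same). -/
theorem curl_conj_isometry (R : (EuclideanSpace ℝ (Fin 3)) ≃ₗᵢ[ℝ] (EuclideanSpace ℝ (Fin 3))) :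
    ∃ ε : ℝ, (ε = 1 ∨ ε = -1) ∧ (∀ a b : (EuclideanSpace ℝ (Fin 3)), cross (R a) (R b) = ε • R (cross a b)) ∧
      ∀ (c : (EuclideanSpace ℝ (Fin 3))) (v : (EuclideanSpace ℝ (Fin 3)) → (EuclideanSpace ℝ (Fin 3))) (y : (EuclideanSpace ℝ (Fin 3))), DifferentiableAt ℝ v (R.symm y + c) →
        curl (fun z => R (v (R.symm z + c))) y = ε • R (curl v (R.symm y + c)) := by
  obtain ⟨M, hM⟩ := exists_matrix_repr R
  obtain ⟨M', hM'⟩ := exists_matrix_repr R.symm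
  -- the two signs agree: `M' * M = 1`
  have hprod : M' * M = 1 := by
    ext i j
    have h : (M' * M) *ᵥ (Pi.single j 1) = Pi.single j 1 := by
      rw [← Matrix.mulVec_mulVec]
      have : (Pi.single j (1 : ℝ) : Fin 3 → ℝ) = ofLp (toLp 2 (Pi.single j (1 : ℝ))) := rfl
      rw [this, hM, hM', LinearIsometryEquiv.symm_apply_apply]
    have := congrFun h i
    rw [Matrix.mulVec_single_one] at this
    simpa [Matrix.one_apply, Pi.single_apply, eq_comm] using this
  have hdet' : M'.det = M.det := by
    have h := congrArg Matrix.det hprod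
    rw [Matrix.det_mul, Matrix.det_one] at h
    rcases repr_det_eq_one_or hM with h1 | h1 <;> rw [h1] at h ⊢ <;> linarith
  have hsq : M.det * M.det = 1 := by
    rcases repr_det_eq_one_or hM with h1 | h1 <;> rw [h1] <;> norm_num
  refine ⟨M.det, repr_det_eq_one_or hM, repr_cross_map hM, fun c v y hv => ?_⟩
  set x := R.symm y + c with hx
  -- the derivative of the conjugated field
  have hA : HasFDerivAt (fun z : (EuclideanSpace ℝ (Fin 3)) => R.symm z + c) (R.symm : (EuclideanSpace ℝ (Fin 3)) →L[ℝ] (EuclideanSpace ℝ (Fin 3))) y :=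
    (R.symm : (EuclideanSpace ℝ (Fin 3)) →L[ℝ] (EuclideanSpace ℝ (Fin 3))).hasFDerivAt.add_const c
  have hcomp : HasFDerivAt (fun z => R (v (R.symm z + c)))
      ((R : (EuclideanSpace ℝ (Fin 3)) →L[ℝ] (EuclideanSpace ℝ (Fin 3))).comp ((fderiv ℝ v x).comp (R.symm : (EuclideanSpace ℝ (Fin 3)) →L[ℝ] (EuclideanSpace ℝ (Fin 3))))) y :=
    (R : (EuclideanSpace ℝ (Fin 3)) →L[ℝ] (EuclideanSpace ℝ (Fin 3))).hasFDerivAt.comp y (hv.hasFDerivAt.comp y hA)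
  have hD : fderiv ℝ (fun z => R (v (R.symm z + c))) y =
      (R : (EuclideanSpace ℝ (Fin 3)) →L[ℝ] (EuclideanSpace ℝ (Fin 3))).comp ((fderiv ℝ v x).comp (R.symm : (EuclideanSpace ℝ (Fin 3)) →L[ℝ] (EuclideanSpace ℝ (Fin 3)))) := hcomp.fderiv
  -- pair with cross products
  have adj : ∀ u w : (EuclideanSpace ℝ (Fin 3)), ⟪u, R w⟫_ℝ = ⟪R.symm u, w⟫_ℝ := fun u w => by
    rw [← LinearIsometryEquiv.inner_map_map R (R.symm u) w, R.apply_symm_apply]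
  have key : ∀ a b : (EuclideanSpace ℝ (Fin 3)),
      ⟪cross a b, curl (fun z => R (v (R.symm z + c))) y - M.det • R (curl v x)⟫_ℝ = 0 := by
    intro a b
    have h1 : ⟪cross a b, curl (fun z => R (v (R.symm z + c))) y⟫_ℝ =
        ⟪cross (R.symm a) (R.symm b), curl v x⟫_ℝ := by
      rw [inner_cross_curl, inner_cross_curl, hD]
      simp only [ContinuousLinearMap.coe_comp, Function.comp_apply]
      change ⟪b, R (fderiv ℝ v x (R.symm a))⟫_ℝ - ⟪a, R (fderiv ℝ v x (R.symm b))⟫_ℝ = _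
      rw [adj, adj]
    have h2 : ⟪cross a b, M.det • R (curl v x)⟫_ℝ = ⟪cross (R.symm a) (R.symm b), curl v x⟫_ℝ := by
      rw [inner_smul_right, adj]
      have hc : R.symm (cross a b) = M.det • cross (R.symm a) (R.symm b) := by
        have h := repr_cross_map hM' a b
        rw [hdet'] at h
        rw [h, smul_smul, hsq, one_smul]
      rw [hc, inner_smul_left]
      simp only [RCLike.conj_to_real]
      rw [← mul_assoc, hsq, one_mul]
    rw [inner_sub_right, h1, h2, sub_self]
  exact sub_eq_zero.1 (eq_zero_of_inner_cross _ key)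

/-! ### Normalisation helpers -/

/-- A vector is mapped onto any ray by a linear isometry: `R a = ‖a‖ • e` for a unit vector `e`
(Householder reflection through the hyperplane bisecting `a` and `‖a‖ e`; Mathlib
`Submodule.reflection_sub`). -/
theorem exists_isometry_map_eq (a e : (EuclideanSpace ℝ (Fin 3))) (he : ‖e‖ = 1) :
    ∃ R : (EuclideanSpace ℝ (Fin 3)) ≃ₗᵢ[ℝ] (EuclideanSpace ℝ (Fin 3)), R a = ‖a‖ • e := by
  have hnorm : ‖a‖ = ‖(‖a‖ : ℝ) • e‖ := by
    rw [norm_smul, norm_norm, he, mul_one]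
  exact ⟨_, Submodule.reflection_sub hnorm⟩

/-- Homogeneity of the cross product in the first factor (from the bilinear `crossCLM`). -/
theorem cross_smul_left' (r : ℝ) (a b : (EuclideanSpace ℝ (Fin 3))) : cross (r • a) b = r • cross a b := by
  rw [← crossCLM_apply, ← crossCLM_apply, map_smul]
  rfl

/-- The curl of a constant field vanishes (all partial derivatives are zero). -/
theorem curl_const_eq_zero (b : (EuclideanSpace ℝ (Fin 3))) (y : (EuclideanSpace ℝ (Fin 3))) : curl (fun _ : (EuclideanSpace ℝ (Fin 3)) => b) y = 0 := by
  have h : fderiv ℝ (fun _ : (EuclideanSpace ℝ (Fin 3)) => b) y = 0 := by simp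
  simp only [curl, h, zero_apply, PiLp.zero_apply, sub_zero]
  ext i
  fin_cases i <;> simp

/-- Slice-wise constancy on `t < 0` transfers back through a rigid motion of the argument and of
the values: if `y ↦ R (v t (R⁻¹ y + c))` is constant for every `t < 0`, so is `v t`. -/
theorem sliceConst_of_conj (v : ℝ → (EuclideanSpace ℝ (Fin 3)) → (EuclideanSpace ℝ (Fin 3))) (R : (EuclideanSpace ℝ (Fin 3)) ≃ₗᵢ[ℝ] (EuclideanSpace ℝ (Fin 3))) (c : (EuclideanSpace ℝ (Fin 3)))
    (h : ∀ t < 0, ∃ b : (EuclideanSpace ℝ (Fin 3)), (fun y => R (v t (R.symm y + c))) = fun _ => b) :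
    ∀ t < 0, ∃ b : (EuclideanSpace ℝ (Fin 3)), v t = fun _ => b := by
  intro t ht
  obtain ⟨b, hb⟩ := h t ht
  refine ⟨R.symm b, funext fun x => ?_⟩
  have hx := congrFun hb (R (x - c))
  simp only [LinearIsometryEquiv.symm_apply_apply, sub_add_cancel] at hx
  rw [← hx, LinearIsometryEquiv.symm_apply_apply]

end Summit.NavierStokesRegularity.NavierStokesRegularity.Theorems.IsobaricLinesLiouville.FluxSurfacePersistence

end
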